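import Mathlib.Algebra.Order.Monoid.TypeTags
import Mathlib.Data.NNRat.Lemmas
import Mathlib.Data.NNReal.Basic
import Literature.AlgebraicGeometry.Frobenioids.PerfFactorial
import Literature.AlgebraicGeometry.Frobenioids.PerfectionDivisorial

/-!
# The primary components `M^pf_𝔮` of the perfection of a perf-factorial monoid are monoprime

Source of the objects: S. Mochizuki, *The geometry of Frobenioids I* [MochizukiFrdI2008], §0 p. 12
(`Prime(M) ≅ Prime(M^pf)`, the submonoids `M_𝔭`) and Def. 2.4 (i) p. 47–48 (perf-factorial monoids;
"one verifies immediately that `M^pf` … [is] also perf-factorial"). Used here as the last input of the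
proof of S. Mochizuki, *The étale theta function …* [MochizukiEtTh2009], Lemma 3.5 (PDF pp. 75–76):
the "`P^rlf`" portion of that lemma works inside the completions `P^pf_𝔮 ⊗ ℝ_{≥0}` and needs each
`P^pf_𝔮` to be monoprime ("the primary component `P_𝔭` associated to `𝔭` is isomorphic to `ℤ_{≥0}`,
`ℚ_{≥0}`, or `ℝ_{≥0}` [cf. [FrdI], Definition 2.4, (i), (b)]", p. 75).

Proved here, stub-free over the tree (`Frobenioids/Monoids.lean`, `PerfFactorial.lean`,
`PerfectionDivisorial.lean`):

* `submonoid_eq_mrange`: for sharp `M` and a prime `𝔮` of `M^pf` lying over the prime `𝔭` of `M`,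
  `M^pf_𝔮` is the image of `(M_𝔭)^pf → M^pf`; hence `pfAt_mulEquiv`: `M^pf_𝔮 ≅ (M_𝔭)^pf`;
* `isMonoprime_perfection`: the perfection of a monoprime monoid is (`ℚ`- or `ℝ`-)monoprime
  (`(ℤ_{≥0})^pf ≅ ℚ_{≥0}`, `(ℚ_{≥0})^pf ≅ ℚ_{≥0}`, `(ℝ_{≥0})^pf ≅ ℝ_{≥0}`);
* `isMonoprime_pfAt`: for perf-factorial `M`, every `M^pf_𝔮` is monoprime — i.e. condition
  [FrdI] Def. 2.4 (i)(b) for `M^pf`.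

Proof-only (no definitions). Seat abc-iut-L2-d2 (cell abc-iut, node EtTh:Lem3.5 rlf portion).
-/

namespace Literature.AnabelianGeometry.EtaleTheta

namespace PerfectionPrimes

open Literature.AlgebraicGeometry.Frobenioids Function NNReal

universe u v

variable {M : Type u} [CommMonoid M]

/-! ### Bookkeeping in `M^pf` -/

/-- `(a·b)^{1/n} = a^{1/n} · b^{1/n}` in `M^pf`. [cite: MochizukiFrdI2008, §0 p.11] -/
theorem mk_mul (a b : M) (n : ℕ+) :
    Perfection.mk (a * b) n = Perfection.mk a n * Perfection.mk b n := by
  rw [Perfection.mk_mul_mk, ← mul_pow, Perfection.mk_pow_mul]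

/-- For sharp `M`, `a^{1/n} ∈ M^pf` is primary iff `a` is. [cite: MochizukiFrdI2008, §0 p.12] -/
theorem isPrimary_mk_iff (hM : IsSharp M) (a : M) (n : ℕ+) :
    IsPrimary (Perfection.mk a n) ↔ IsPrimary a := by
  rw [← Perfection.isPrimary_of_iff hM]
  have h1 := Perfection.mk_precsim_of a n
  constructor
  · intro h
    rw [← Perfection.mk_pow_self]
    exact h.pow (Perfection.isSharp hM) n.pos
  · intro h
    refine h.of_precsim h1.1 fun h0 => h.1 ?_
    rw [← Perfection.mk_pow_self, h0, one_pow]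

/-! ### `M^pf_𝔮` is the image of `(M_𝔭)^pf` -/

/-- For sharp `M`, `a ∈ M` primary and `k ≥ 1`: the submonoid `M^pf_𝔮` of the prime `𝔮` of `M^pf`
containing `a^{1/k}` is the image of `(M_𝔭)^pf → M^pf`, where `𝔭` is the prime of `M` containing `a`
(`Prime(M) ≅ Prime(M^pf)`, [FrdI] §0 p. 12). [cite: MochizukiFrdI2008, §0 p.12] -/
theorem submonoid_eq_mrange (hM : IsSharp M) {a : M} (ha : IsPrimary a) (k : ℕ+)
    (hx : IsPrimary (Perfection.mk a k)) :
    Primes.submonoid (Quotient.mk (primarySetoid (Perfection M)) ⟨Perfection.mk a k, hx⟩) =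
      MonoidHom.mrange (Perfection.map
        (Primes.submonoid (Quotient.mk (primarySetoid M) ⟨a, ha⟩)).subtype) := by
  set 𝔭 : Primes M := Quotient.mk (primarySetoid M) ⟨a, ha⟩ with h𝔭
  set 𝔮 : Primes (Perfection M) := Quotient.mk (primarySetoid (Perfection M)) ⟨Perfection.mk a k, hx⟩
    with h𝔮
  have hak := Perfection.mk_precsim_of a k
  apply le_antisymm
  · -- `M^pf_𝔮 ⊆ image`: generators are `b^{1/n}` with `b ∈ 𝔭`
    rw [Primes.submonoid, Submonoid.closure_le]
    rintro y ⟨hy, hcls⟩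
    obtain ⟨⟨b, n⟩, rfl⟩ := Perfection.mk_surjective y
    dsimp only at hy hcls ⊢
    have hb : IsPrimary b := (isPrimary_mk_iff hM b n).mp hy
    have hbn := Perfection.mk_precsim_of b n
    have hba : b ≼ a := by
      have h1 : Perfection.mk b n ≼ Perfection.mk a k := Quotient.exact hcls
      exact Perfection.of_precsim_of_iff.mp ((hbn.2.trans h1).trans hak.1)
    have hbmem : b ∈ 𝔭.submonoid :=
      Submonoid.subset_closure ⟨hb, Quotient.sound hba⟩
    exact ⟨Perfection.mk ⟨b, hbmem⟩ n, by rw [Perfection.map_mk]; rfl⟩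
  · -- `image ⊆ M^pf_𝔮`: induction on the generators of `M_𝔭`
    rintro _ ⟨z, rfl⟩
    obtain ⟨⟨⟨s, hs⟩, n⟩, rfl⟩ := Perfection.mk_surjective z
    dsimp only
    rw [Perfection.map_mk, Submonoid.subtype_apply]
    induction hs using Submonoid.closure_induction with
    | mem s hs =>
      obtain ⟨hs, hcls⟩ := hs
      apply Submonoid.subset_closure
      refine ⟨(isPrimary_mk_iff hM s n).mpr hs, Quotient.sound ?_⟩
      have hsa : s ≼ a := Quotient.exact hcls
      show Perfection.mk s n ≼ Perfection.mk a k
      exact ((Perfection.mk_precsim_of s n).1.trans (Precsim.map (Perfection.of M) hsa)).trans hak.2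
    | one => rw [Perfection.mk_one]; exact Submonoid.one_mem _
    | mul s t _ _ ihs iht => rw [mk_mul]; exact Submonoid.mul_mem _ ihs iht

/-- For sharp `M`: every `M^pf_𝔮` is isomorphic to `(M_𝔭)^pf` for a prime `𝔭` of `M` (the one
corresponding to `𝔮` under `Prime(M) ≅ Prime(M^pf)`, [FrdI] §0 p. 12). [cite: MochizukiFrdI2008, §0 p.12] -/
theorem pfAt_mulEquiv (hM : IsSharp M) (𝔮 : Primes (Perfection M)) :
    ∃ 𝔭 : Primes M, Nonempty (PfAt M 𝔮 ≃* Perfection ↥𝔭.submonoid) := by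
  obtain ⟨⟨x, hx⟩, rfl⟩ := Quotient.mk_surjective 𝔮
  obtain ⟨⟨a, k⟩, rfl⟩ := Perfection.mk_surjective x
  dsimp only at hx ⊢
  have ha : IsPrimary a := (isPrimary_mk_iff hM a k).mp hx
  set 𝔭 : Primes M := Quotient.mk (primarySetoid M) ⟨a, ha⟩ with h𝔭
  let j : Perfection ↥𝔭.submonoid →* Perfection M := Perfection.map 𝔭.submonoid.subtype
  have hj : Injective j := Perfection.map_injective _ Subtype.val_injective
  have hjr : Bijective j.mrangeRestrict :=
    ⟨fun x y h => hj (congrArg Subtype.val h), MonoidHom.mrangeRestrict_surjective j⟩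
  have heq := submonoid_eq_mrange hM ha k hx
  exact ⟨𝔭, ⟨(MulEquiv.submonoidCongr heq).trans (MulEquiv.ofBijective j.mrangeRestrict hjr).symm⟩⟩

/-! ### Perfections of monoprime monoids -/

/-- `ℚ_{≥0}` (written multiplicatively) is perfect. [cite: MochizukiFrdI2008, §0 p.11] -/
theorem isPerfect_nnrat : IsPerfect (Multiplicative ℚ≥0) := by
  refine ⟨fun n hn => ⟨fun x y h => ?_, fun y => ?_⟩⟩
  · have hn' : (n : ℚ≥0) ≠ 0 := by exact_mod_cast hn.ne'
    have h' : (n : ℚ≥0) * Multiplicative.toAdd x = n * Multiplicative.toAdd y := by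
      have := congrArg Multiplicative.toAdd h
      simpa only [toAdd_pow, nsmul_eq_mul] using this
    exact Multiplicative.toAdd.injective (mul_left_cancel₀ hn' h')
  · have hn' : (n : ℚ≥0) ≠ 0 := by exact_mod_cast hn.ne'
    refine ⟨Multiplicative.ofAdd (Multiplicative.toAdd y / n), ?_⟩
    apply Multiplicative.toAdd.injective
    simp only [toAdd_pow, toAdd_ofAdd, nsmul_eq_mul]
    exact mul_div_cancel₀ _ hn'

/-- `ℝ_{≥0}` (written multiplicatively) is perfect. [cite: MochizukiFrdI2008, §0 p.11] -/
theorem isPerfect_nnreal : IsPerfect (Multiplicative ℝ≥0) := by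
  refine ⟨fun n hn => ⟨fun x y h => ?_, fun y => ?_⟩⟩
  · have hn' : (n : ℝ≥0) ≠ 0 := by exact_mod_cast hn.ne'
    have h' : (n : ℝ≥0) * Multiplicative.toAdd x = n * Multiplicative.toAdd y := by
      have := congrArg Multiplicative.toAdd h
      simpa only [toAdd_pow, nsmul_eq_mul] using this
    exact Multiplicative.toAdd.injective (mul_left_cancel₀ hn' h')
  · have hn' : (n : ℝ≥0) ≠ 0 := by exact_mod_cast hn.ne'
    refine ⟨Multiplicative.ofAdd (Multiplicative.toAdd y / n), ?_⟩
    apply Multiplicative.toAdd.injective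
    simp only [toAdd_pow, toAdd_ofAdd, nsmul_eq_mul]
    exact mul_div_cancel₀ _ hn'

/-- `(ℤ_{≥0})^pf ≅ ℚ_{≥0}`: the perfection of `ℤ_{≥0}` is `ℚ_{≥0}` ([FrdI] §0 p. 11, the inductive
limit of `ℤ_{≥0} —n·→ ℤ_{≥0}`). [cite: MochizukiFrdI2008, §0 p.11] -/
theorem isQMonoprime_perfection_nat : IsQMonoprime (Perfection (Multiplicative ℕ)) := by
  let c : Multiplicative ℕ →* Multiplicative ℚ≥0 :=
    AddMonoidHom.toMultiplicative (Nat.castAddMonoidHom ℚ≥0)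
  have hc : Injective c := fun a b hab =>
    Multiplicative.toAdd.injective (Nat.cast_injective (R := ℚ≥0) (Multiplicative.ofAdd.injective hab))
  let e := isPerfect_nnrat.equivPerfection
  let g : Perfection (Multiplicative ℕ) →* Multiplicative ℚ≥0 :=
    e.symm.toMonoidHom.comp (Perfection.map c)
  have hg : Bijective g := by
    constructor
    · exact e.symm.injective.comp (Perfection.map_injective c hc)
    · intro q
      refine ⟨Perfection.mk (Multiplicative.ofAdd (Multiplicative.toAdd q).num)
        ⟨(Multiplicative.toAdd q).den, (Multiplicative.toAdd q).den_pos⟩, ?_⟩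
      show e.symm (Perfection.map c _) = q
      rw [MulEquiv.symm_apply_eq, Perfection.map_mk, IsPerfect.equivPerfection_apply, Perfection.of_apply,
        Perfection.mk_eq_mk_iff]
      refine ⟨1, ?_⟩
      apply Multiplicative.toAdd.injective
      simp only [PNat.one_coe, PNat.mk_coe, one_mul, mul_one, toAdd_pow, pow_one, nsmul_eq_mul]
      show Multiplicative.toAdd (c (Multiplicative.ofAdd (Multiplicative.toAdd q).num)) =
        ((Multiplicative.toAdd q).den : ℚ≥0) * Multiplicative.toAdd q
      rw [NNRat.den_mul_eq_num]
      rfl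
  exact ⟨⟨MulEquiv.ofBijective g hg⟩⟩

/-- A monoid isomorphic to a monoprime monoid is monoprime. [cite: MochizukiFrdI2008, §0 p.10] -/
theorem isMonoprime_of_mulEquiv {A B : Type u} [CommMonoid A] [CommMonoid B] (e : A ≃* B)
    (h : IsMonoprime A) : IsMonoprime B := by
  rcases h with ⟨⟨⟨e₀⟩⟩⟩ | ⟨⟨⟨e₀⟩⟩⟩ | ⟨⟨⟨e₀⟩⟩⟩
  · exact IsMonoprime.ofZ ⟨⟨e.symm.trans e₀⟩⟩
  · exact IsMonoprime.ofQ ⟨⟨e.symm.trans e₀⟩⟩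
  · exact IsMonoprime.ofR ⟨⟨e.symm.trans e₀⟩⟩

/-- `M^pf` is functorial in isomorphisms ACROSS universes: `A ≅ B` induces `A^pf ≅ B^pf` (the tree's
`Perfection.congr` with the two monoids in possibly different universes, as needed to compare an
abstract `M_𝔭` with the concrete `ℤ_{≥0}`, `ℚ_{≥0}`, `ℝ_{≥0}`). [cite: MochizukiFrdI2008, §0 p.11] -/
theorem nonempty_perfection_congr {A : Type u} {B : Type v} [CommMonoid A] [CommMonoid B]
    (e : A ≃* B) : Nonempty (Perfection A ≃* Perfection B) := by
  let j : Perfection A →* Perfection B :=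
    { toFun := Quotient.map (fun x => (e x.1, x.2)) fun x y ⟨K, h⟩ => ⟨K, by
        show e x.1 ^ ((K : ℕ) * (y.2 : ℕ)) = e y.1 ^ ((K : ℕ) * (x.2 : ℕ))
        rw [← map_pow, ← map_pow, h]⟩
      map_one' := by
        show Perfection.mk (e 1) 1 = Perfection.mk 1 1
        rw [map_one]
      map_mul' := fun x y => by
        obtain ⟨⟨a, n⟩, rfl⟩ := Perfection.mk_surjective x
        obtain ⟨⟨b, m⟩, rfl⟩ := Perfection.mk_surjective y
        show Perfection.mk (e (a ^ (m : ℕ) * b ^ (n : ℕ))) (n * m) =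
          Perfection.mk (e a ^ (m : ℕ) * e b ^ (n : ℕ)) (n * m)
        rw [map_mul, map_pow, map_pow] }
  have hj : ∀ (a : A) (n : ℕ+), j (Perfection.mk a n) = Perfection.mk (e a) n := fun _ _ => rfl
  refine ⟨MulEquiv.ofBijective j ⟨?_, ?_⟩⟩
  · intro x y hxy
    obtain ⟨⟨a, n⟩, rfl⟩ := Perfection.mk_surjective x
    obtain ⟨⟨b, m⟩, rfl⟩ := Perfection.mk_surjective y
    dsimp only at hxy ⊢
    rw [hj, hj, Perfection.mk_eq_mk_iff] at hxy
    obtain ⟨K, hK⟩ := hxy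
    rw [← map_pow, ← map_pow] at hK
    exact Perfection.mk_eq_mk_iff.mpr ⟨K, e.injective hK⟩
  · intro y
    obtain ⟨⟨b, m⟩, rfl⟩ := Perfection.mk_surjective y
    exact ⟨Perfection.mk (e.symm b) m, by dsimp only; rw [hj, MulEquiv.apply_symm_apply]⟩

/-- **The perfection of a monoprime monoid is monoprime** (in fact `ℚ`- or `ℝ`-monoprime):
`(ℤ_{≥0})^pf ≅ (ℚ_{≥0})^pf ≅ ℚ_{≥0}`, `(ℝ_{≥0})^pf ≅ ℝ_{≥0}`. [cite: MochizukiFrdI2008, §0 p.11] -/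
theorem isMonoprime_perfection {S : Type u} [CommMonoid S] (hS : IsMonoprime S) :
    IsMonoprime (Perfection S) := by
  rcases hS with ⟨⟨⟨e⟩⟩⟩ | ⟨⟨⟨e⟩⟩⟩ | ⟨⟨⟨e⟩⟩⟩
  · obtain ⟨e'⟩ := nonempty_perfection_congr e
    obtain ⟨⟨e₁⟩⟩ := isQMonoprime_perfection_nat
    exact IsMonoprime.ofQ ⟨⟨e'.trans e₁⟩⟩
  · obtain ⟨e'⟩ := nonempty_perfection_congr e
    exact IsMonoprime.ofQ ⟨⟨e'.trans isPerfect_nnrat.equivPerfection.symm⟩⟩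
  · obtain ⟨e'⟩ := nonempty_perfection_congr e
    exact IsMonoprime.ofR ⟨⟨e'.trans isPerfect_nnreal.equivPerfection.symm⟩⟩

/-- The perfection of an `ℝ`-monoprime monoid is `ℝ`-monoprime. [cite: MochizukiFrdI2008, §0 p.11] -/
theorem isRMonoprime_perfection {S : Type u} [CommMonoid S] (hS : IsRMonoprime S) :
    IsRMonoprime (Perfection S) := by
  obtain ⟨⟨e⟩⟩ := hS
  obtain ⟨e'⟩ := nonempty_perfection_congr e
  exact ⟨⟨e'.trans isPerfect_nnreal.equivPerfection.symm⟩⟩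

/-! ### Def. 2.4 (i)(b) for `M^pf` -/

/-- **Every `M^pf_𝔮` of a perf-factorial monoid is monoprime** — condition [FrdI] Def. 2.4 (i)(b) for
`M^pf` (part of "one verifies immediately that `M^pf` … [is] also perf-factorial", Def. 2.4 (i) p. 48):
`M^pf_𝔮 ≅ (M_𝔭)^pf` with `M_𝔭` monoprime. [cite: MochizukiFrdI2008, Def. 2.4(i) p.48] -/
theorem isMonoprime_pfAt (hM : IsPerfFactorial M) (𝔮 : Primes (Perfection M)) :
    IsMonoprime (PfAt M 𝔮) := by
  obtain ⟨𝔭, ⟨e⟩⟩ := pfAt_mulEquiv hM.isDivisorial.isSharp 𝔮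
  exact isMonoprime_of_mulEquiv e.symm (isMonoprime_perfection (hM.isMonoprime 𝔭))

end PerfectionPrimes

end Literature.AnabelianGeometry.EtaleTheta
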